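import Mathlib
import HarnessLib
import HarnessLib.Audit
import Summits.RiemannHypothesis.Statement
import HarnessLib.Audit.Status.Attr

/-!
Route: WeilAutocorrelation

# Route WeilAutocorrelation — short-lag monotone autocorrelation of Weil ground states vs the
off-line wall oscillation

It suffices to show X = X1 ∧ X2fin ∧ X2inf about the L²-bottom ("ground state") u of Weil's windowed
quadratic form
Q on tests supported in [−a, a] (encoded inline over Mathlib primitives exactly as
Theses/GroundBarta.lean rev 1:
C = g ⋆ g̃, M = Mellin–Laplace, Q = polar − prime + archimedean; ground state = L²-limit of an
L²-normalised
asymptotically minimising sequence of smooth window tests) and its lag autocorrelation K_u(y) = ∫ Re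
u(t) Re u(t+y) dt.
X1 (ShortLagAutocorrDecay, deciding): for cofinally many windows a there is a real ground state
whose K_u is
ANTITONE on the lag interval (0, 1]. X2fin (OffLineAutocorrRiseFin): if RH fails with finitely many
off-line zeros,
then for all large windows every real ground state has K_u NOT antitone on (0, 1] (the bottom
condenses on the
deepest off-line wall mode e^{(β−1/2)t} cos(γt), γ > 2516, whose autocorrelation rises within a lag
2π/γ < 1/2).
X2inf (OffLineAutocorrRiseInf): the same conclusion if there are infinitely many off-line zeros. The
sketch
weil-autocorrelation-door (markdown wave, reader PASS) is realised verbatim; no idea card exists for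
it.
Lean: `ShortLagAutocorrDecay ∧ OffLineAutocorrRiseFin ∧ OffLineAutocorrRiseInf`

## Assembly
Pure logic (sorry-free `closes` in glue.lean, axioms propext/Classical.choice/Quot.sound): assume
¬RH; the off-line zero
set is finite or infinite (`Set.finite_or_infinite`); OffLineAutocorrRiseFin resp.
OffLineAutocorrRiseInf gives a threshold
A beyond which no real ground state has antitone K on (0,1]; ShortLagAutocorrDecay at that A gives a
window a ≥ A and a
real ground state with antitone K — contradiction. All three binders are consumed.

Rationale: WHY THIS LINE. Weil's criterion (Bombieri2000Weil Thm 10–12; Yoshida1992HermitianForms Thm 1; tree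
`weilPositivity_iff_riemannHypothesis`)
makes RH a positivity statement, and every positivity route on this hub (GroundBarta, OddSector,
WeilGroundState,
ShiftedResolvent) attacks a SIGN or a NON-VANISHING of the windowed bottom. This line replaces the
sign by a SHAPE
invariant in the lag domain: under RH the bottom is a smooth arch decorated IN PHASE by prime teeth
at the fixed lags
log(m/n) (Bombieri2000Weil §13 variational equation; arXiv:2606.09096 Thm 1.1/1.3 theta-likeness;
arXiv:2511.22755
semilocal prolate bottom), and in-phase decoration keeps K_u decreasing at short lags; under ¬RH the
bottom must ride
the exponential wall of an off-line zero ρ = β+iγ and K_u inherits the oscillation cos(γy), which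
RISES inside (0,1]
because every zeta zero has |γ| > 2516 (tree `riemannHypothesisInStripUpTo_2516`). Imported:
variational / ground-state
analysis (calculus of variations), autocorrelation-shape criteria (harmonic analysis: strip
positivity of the derivative
autocorrelation), Turán–Nazarov-type lower bounds for finite exponential sums (X2fin). What it does
that prior routes do
not: the discriminating functional is monotonicity of K_u on a fixed lag window, not a positivity
margin, so it is not a
reformulation of Weil positivity on any window and is falsifiable by certified Ritz numerics at a =
1.

RANKED CRUXES. #2 ShortLagAutocorrDecay (crux) — for every A there is a window a ≥ A and a ground
state u of Weil's windowed form at a (L²-limit of an L²-normalised asymptotically Q-minimising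
sequence of smooth tests supported in [−a,a]) with Im u = 0 a.e. whose autocorrelation y ↦ ∫ Re u(t)
Re u(t+y) dt is antitone on the lag interval (0,1] (sketch X1, ∃-window form). [difficulty:
open-problem] (why it might fail: RH-strength shape claim: even under RH the teeth of a large-window
bottom could dephase K_u below lag 1 (W-shape is known past a = ½log2 for K itself near lag log 2 >
1 only by a margin); a certified Ritz computation at a = 1 showing a rise on (0,1] kills it.)
[Bombieri2000Weil, Yoshida1992HermitianForms, arXiv:2606.09096, arXiv:2511.22755,
doi:10.4153/S0008414X25101739]
#3 OffLineAutocorrRiseFin (crux) — if RH fails and the set of off-line zeros in the critical strip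
is finite, then there is A such that for every window a ≥ A every real ground state u at a has
autocorrelation NOT antitone on (0,1] (condensation on the deepest wall modes e^{(Re
ρ−1/2)t}cos/sin(Im ρ·t), |Im ρ| > 2516, plus a no-monotone-interval lemma for sums of ≤ 2N damped
sinusoids). [difficulty: L] (why it might fail: exact ties Re ρ_j = β* with several ordinates make
the condensed bottom a ≤2N-frequency mixture; the rise on (0,1] then needs a quantitative
Turán–Nazarov no-monotone-interval bound beating the clustering (≤ c·log γ zeros per unit height),
not just one cosine.) [Bombieri2000Weil, arXiv:2606.09096, Nazarov1993LocalEstimates,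
riemannHypothesisInStripUpTo_2516]
#4 OffLineAutocorrRiseInf (crux) — if the set of off-line zeros of ζ in the critical strip is
infinite, then there is A such that for every window a ≥ A every real ground state u at a has
autocorrelation NOT antitone on (0,1] (the infinitely-many-walls case, named honestly as its own
item). [difficulty: open-problem] (why it might fail: with infinitely many near-tied off-line zeros
(β_j ↑ sup, γ_j → ∞) the bottom may be an infinite high-frequency mixture with no finite
condensation, or no L² ground state exists at large windows (then the item is vacuous and all weight
falls on ShortLagAutocorrDecay's existence clause).) [Bombieri2000Weil, arXiv:2511.22755,
arXiv:2606.09096]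

TWO-LAYER PLAN. Foreseen glued splits (filed only after a crux closes or by tenure):
ShortLagAutocorrDecay ⇐ StripCriterion (strip-positivity
of the derivative autocorrelation ⇒ antitone K, provable-now) → LimitStability (antitone passes to
L² limits, provable-now) →
ShapeCore (cofinal windows with strip-positive smooth approximants; the XL piece) — exactly the
registered birth skeleton;
OffLineAutocorrRiseFin ⇐ CondensationFin (bounded-complexity condensation on ≤ N wall modes) →
RobustRiseBounded (no antitone K
within δ of a unit vector of the wall span); OffLineAutocorrRiseInf ⇐ CondensationInf →
RobustRiseBounded (shared child).

KILL CRITERIA. A certified computation or theorem showing that for some A every window a ≥ A has NO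
real ground state with antitone K on (0,1]
refutes ShortLagAutocorrDecay and closes the route `refuted:ShortLagAutocorrDecay` (first repair if
the failure sits at lags
near 1 only: re-file with lag window (0, L], L = 1/4 — OffLineAutocorrRiseFin needs only L >
2π/2516). A finite off-line
configuration (hypothetical) whose condensed bottom has antitone K on (0,1] refutes
OffLineAutocorrRiseFin as typed ⇒ pivot to
the strict-margin variant. WeilPositivity (tree, @[conjecture]) or GroundBarta/OddSector proved
elsewhere moots the route.

NOT DECOMPOSED YET. Existence of L² ground states at large windows (inside ShortLagAutocorrDecay;
CCM25/Suzuki give it only for small windows);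
the Turán–Nazarov constant bookkeeping of OffLineAutocorrRiseFin; any effective finiteness /
zero-density input for
OffLineAutocorrRiseInf; the choice of cofinal windows (parity of the bottom, cf. OddSector) — all
layer-2, later.

CHEAPEST FALSIFIER. Certified Ritz–Galerkin numerics (interval arithmetic, sinc or B-spline basis, n
≈ 400) of the windowed bottom at a = 1.0 and
a = 1.5: tabulate K_u on a lag grid of (0,1]; a rise robust across discretisations kills
ShortLagAutocorrDecay at those windows
and, if it persists for a ∈ [1,3], the line. Not run in this typing session (no kit budget in the
payload); it is the first
refuter job. Lookup falsifier for OffLineAutocorrRiseFin: Nazarov's local estimate for exponential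
polynomials (≤ 2N terms)
gives sup over any interval of length 2π/γ·c(N) — check the constant suffices inside (0,1] for γ >
2516.

NUMBERS. γ₁ = 14.134725 (first zeta ordinate), 2π/γ₁ = 0.4445 < 1/2; tree: no zeros off the line
with |Im| ≤ 2516
(`riemannHypothesisInStripUpTo_2516`), so a wall oscillation completes > 400 periods inside (0,1].
Weil positivity known for
windows a ≤ ½log2 = 0.346574 (Yoshida1992HermitianForms Thm 1; tree
`weilPositivityOn_log_two_half_holds`); first prime tooth at
lag log 2 = 0.6931 enters the form only for a > ½log2. Items at open: 4 (3 cruxes + assembly).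

DEFINITION REQUESTS. None: everything is stated over Mathlib primitives (MeasureTheory.convolution,
MemLp, ContDiff, tsupport, riemannZeta,
ArithmeticFunction.vonMangoldt, Complex.digamma, AntitoneOn); the inline lets are definitionally the
GroundBarta rev-1 encoding.

Novelty: Searches (2026-08-17): `lit search --hybrid "Weil explicit formula quadratic form ground state
minimizer autocorrelation"` (10 docs: arXiv:2511.22755 pp 5,33–34; galaxy-pdf-4005501466549090220
Bombieri; rest signal-processing noise); `lit vsearch "minimizer of Weil's quadratic form … shape of
the extremal function"` (10 docs, none on topic); `lit search --hybrid "Yoshida Hermitian form Weil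
positivity small support log 2"` (yoshida2018-hermitian-forms-attached-zeta-functions p.3 Thm 1;
arXiv:2511.22755); `lit galaxy search "Weil's quadratic functional|Weil positivity|…" --star all`
(panama 5 books: Borwein et al. RH resource 432889753763913, Jia–Matsumoto 504426729046016, van
Frankenhuijsen 328109731610713, Terras, Lapidus; pdf/crabby timed out once); `lit galaxy search
"Weil's quadratic form|Weil quadratic functional|semi-local trace formula|prolate wave operator"
--star pdf` (2: pdf:4005501466549090220 Bombieri 2000; pdf:4905270340 Suzuki CJM 2025 "On the
Hilbert space derived from the Weil distribution"); `ledger negatives --problem RiemannHypothesis`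
(2, unrelated); 36 Theses of the sub read for dedup (bc/dedup.lean).
Nearest prior art found: [galaxy:pdf:4005501466549090220] Bombieri2000Weil Thm 10–12, §13
(variational equation of the windowed minimum, no autocorrelation shape);
[corpus:paper:yoshida2018-hermitian-forms-attached-zeta-functions p.3] Thm 1 (positivity for a ≤
log2/2); [corpus:paper:arxiv-2511.22755] Connes–Consani–Moscovici 2025 (semilocal prolate bottom, z  [refs: 2511.22755, paper:yoshida2018-hermitian-forms-attached-zeta-functions, paper:arxiv-2511.22755, paper:arxiv-2606.09096]

Barriers (technique_class: weil-explicit-formula, ground-state, autocorrelation-shape): - technique_class: weil-explicit-formula, ground-state, autocorrelation-shape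
- Literature.Barriers.RiemannHypothesis.DiamondMontgomeryVorhauer2006_thm1: conceded in scope —
Beurling systems with off-line zeros satisfy every "abstract" input, and Bombieri2000Weil Thm 11
shows Weil-form positivity cannot follow from the functional equation + a generic Euler product;
ShortLagAutocorrDecay is stated for ζ's own form with von Mangoldt weights at the rigid lags log n
of the INTEGERS, and its proof must use that rigidity (teeth pairs at lags log((n+1)/n) → 0 in
phase); the X2 items are insensitive to the barrier (they hold verbatim for a Beurling system with
off-line zeros, where the X1-analogue is then false, as it must be).
- Literature.Barriers.RiemannHypothesis.DavenportHeilbronn: outside — the Davenport–Heilbronn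
function has the functional equation but no Euler product; Q carries the Euler product through the
Λ(n) prime sum, and the line predicts (correctly) that the DH-analogue of ShortLagAutocorrDecay
fails because DH has off-line zeros (X2 mechanism) — a consistency check, not an obstruction.
- Literature.Barriers.RiemannHypothesis.DeBrangesPositivity: outside — no de Branges space,
E-function or kernel-positivity condition (ConreyLi2000_HE/FW) is asserted; the cruxes are shape
statements about L²-minimisers of Weil's form, and Weil positivity is reached only through `closes`
by contradiction.
- Literature.Barriers.RiemannHypothesis.NewmanConjecture: inside in spirit ("RH

sub-problem: RiemannHypothesis · status: draft · opened planner-type-d2b34ffd30-0 2026-08-17T19:06:09Z · rev 0 · ledger route-RiemannHypothesis-WeilAutocorrelation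
GENERATED by the gate from the ledger (D-0016/17). Provers cite these decls: `theorem foo : Summit.RiemannHypothesis.RiemannHypothesis.Theses.WeilAutocorrelation.<Decl> := …` in Summits/RiemannHypothesis/RiemannHypothesis/Theorems/<Name>.lean.
-/

namespace Summit.RiemannHypothesis.RiemannHypothesis.Theses.WeilAutocorrelation

open scoped BigOperators Topology Manifold Classical MeasureTheory ProbabilityTheory Matrix InnerProductSpace ComplexConjugate ContinuousMap
open Filter Set Function TopologicalSpace MeasureTheory

attribute [summit_statement] _root_.Summit.RiemannHypothesis

open Summit

/-- item stmt-RiemannHypothesis-19991 · crux · rank 2 · open · by planner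
why it might fail: RH-strength shape claim: even under RH the teeth of a large-window bottom could dephase K_u below lag 1 (W-shape is known past a = ½log2 for K itself near lag log 2 > 1 only by a margin); a certified Ritz computation at a = 1 showing a rise on (0,1] kills it.
sources: Bombieri2000Weil, Yoshida1992HermitianForms, arXiv:2606.09096, arXiv:2511.22755, doi:10.4153/S0008414X25101739
[crux] for every A there is a window a ≥ A and a ground state u of Weil's windowed form at a
(L²-limit of an L²-normalised asymptotically Q-minimising sequence of smooth tests supported in
[−a,a]) with Im u = 0 a.e. whose autocorrelation y ↦ ∫ Re u(t) Re u(t+y) dt is antitone on the lag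
interval (0,1] (sketch X1, ∃-window form). [difficulty: open-problem] -/
@[route_item "route-RiemannHypothesis-WeilAutocorrelation", crux]
def ShortLagAutocorrDecay : Prop :=
  let C : (ℝ → ℂ) → ℝ → ℂ := fun g => MeasureTheory.convolution g (fun t => (starRingEnd ℂ) (g (-t))) (ContinuousLinearMap.mul ℂ ℂ) MeasureTheory.MeasureSpace.volume; let M : (ℝ → ℂ) → ℂ → ℂ := fun F s => ∫ t : ℝ, F t * Complex.exp ((s - 1 / 2) * t); let Q : (ℝ → ℂ) → ℂ := fun g => M (C g) 0 + M (C g) 1 - (∑' n : ℕ, ((ArithmeticFunction.vonMangoldt n : ℝ) : ℂ) / (Real.sqrt n : ℂ) * (C g (Real.log n) + C g (-Real.log n))) + ((1 / (2 * Real.pi) : ℂ) * (∫ t : ℝ, M (C g) (1 / 2 + t * Complex.I) * ((Complex.digamma (1 / 4 + t / 2 * Complex.I)).re : ℂ)) - C g 0 * (Real.log Real.pi : ℂ)); ∀ A : ℝ, ∃ a : ℝ, A ≤ a ∧ ∃ u : ℝ → ℂ, (MeasureTheory.MemLp u 2 ∧ ∃ g : ℕ → ℝ → ℂ, (∀ n,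 (ContDiff ℝ ((⊤ : ℕ∞) : WithTop ℕ∞) (g n) ∧ HasCompactSupport (g n)) ∧ tsupport (g n) ⊆ Set.Icc (-a) a ∧ ∫ t, ‖g n t‖ ^ 2 = (1 : ℝ)) ∧ (∀ h : ℝ → ℂ, (ContDiff ℝ ((⊤ : ℕ∞) : WithTop ℕ∞) h ∧ HasCompactSupport h) → tsupport h ⊆ Set.Icc (-a) a → ∫ t, ‖h t‖ ^ 2 = (1 : ℝ) → ∀ δ : ℝ, 0 < δ → ∀ᶠ n in Filter.atTop, (Q (g n)).re ≤ (Q h).re + δ) ∧ Filter.Tendsto (fun n => ∫ t, ‖g n t - u t‖ ^ 2) Filter.atTop (nhds 0)) ∧ (∀ᵐ t : ℝ, (u t).im = 0) ∧ AntitoneOn (fun y : ℝ => ∫ t : ℝ, (u t).re * (u (t + y)).re) (Set.Ioc (0 : ℝ) 1)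

/-- item stmt-RiemannHypothesis-19992 · crux · rank 3 · open · by planner
why it might fail: exact ties Re ρ_j = β* with several ordinates make the condensed bottom a ≤2N-frequency mixture; the rise on (0,1] then needs a quantitative Turán–Nazarov no-monotone-interval bound beating the clustering (≤ c·log γ zeros per unit height), not just one cosine.
sources: Bombieri2000Weil, arXiv:2606.09096, Nazarov1993LocalEstimates, riemannHypothesisInStripUpTo_2516
[crux] if RH fails and the set of off-line zeros in the critical strip is finite, then there is A
such that for every window a ≥ A every real ground state u at a has autocorrelation NOT antitone on
(0,1] (condensation on the deepest wall modes e^{(Re ρ−1/2)t}cos/sin(Im ρ·t), |Im ρ| > 2516, plus a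
no-monotone-interval lemma for sums of ≤ 2N damped sinusoids). [difficulty: L] -/
@[route_item "route-RiemannHypothesis-WeilAutocorrelation", crux]
def OffLineAutocorrRiseFin : Prop :=
  let C : (ℝ → ℂ) → ℝ → ℂ := fun g => MeasureTheory.convolution g (fun t => (starRingEnd ℂ) (g (-t))) (ContinuousLinearMap.mul ℂ ℂ) MeasureTheory.MeasureSpace.volume; let M : (ℝ → ℂ) → ℂ → ℂ := fun F s => ∫ t : ℝ, F t * Complex.exp ((s - 1 / 2) * t); let Q : (ℝ → ℂ) → ℂ := fun g => M (C g) 0 + M (C g) 1 - (∑' n : ℕ, ((ArithmeticFunction.vonMangoldt n : ℝ) : ℂ) / (Real.sqrt n : ℂ) * (C g (Real.log n) + C g (-Real.log n))) + ((1 / (2 * Real.pi) : ℂ) * (∫ t : ℝ, M (C g) (1 / 2 + t * Complex.I) * ((Complex.digamma (1 / 4 + t / 2 * Complex.I)).re : ℂ)) - C g 0 * (Real.log Real.pi : ℂ)); ¬ RiemannHypothesis → {s : ℂ | riemannZeta s = 0 ∧ 0 < s.re ∧ s.re < 1 ∧ s.re ≠ 1 / 2}.Finite → ∃ A : ℝ,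 ∀ a : ℝ, A ≤ a → ∀ u : ℝ → ℂ, (MeasureTheory.MemLp u 2 ∧ ∃ g : ℕ → ℝ → ℂ, (∀ n, (ContDiff ℝ ((⊤ : ℕ∞) : WithTop ℕ∞) (g n) ∧ HasCompactSupport (g n)) ∧ tsupport (g n) ⊆ Set.Icc (-a) a ∧ ∫ t, ‖g n t‖ ^ 2 = (1 : ℝ)) ∧ (∀ h : ℝ → ℂ, (ContDiff ℝ ((⊤ : ℕ∞) : WithTop ℕ∞) h ∧ HasCompactSupport h) → tsupport h ⊆ Set.Icc (-a) a → ∫ t, ‖h t‖ ^ 2 = (1 : ℝ) → ∀ δ : ℝ, 0 < δ → ∀ᶠ n in Filter.atTop, (Q (g n)).re ≤ (Q h).re + δ) ∧ Filter.Tendsto (fun n => ∫ t, ‖g n t - u t‖ ^ 2) Filter.atTop (nhds 0)) → (∀ᵐ t : ℝ, (u t).im = 0) → ¬ AntitoneOn (fun y : ℝ => ∫ t : ℝ, (u t).re * (u (t + y)).re) (Set.Ioc (0 : ℝ) 1)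

/-- item stmt-RiemannHypothesis-19993 · crux · rank 4 · open · by planner
why it might fail: with infinitely many near-tied off-line zeros (β_j ↑ sup, γ_j → ∞) the bottom may be an infinite high-frequency mixture with no finite condensation, or no L² ground state exists at large windows (then the item is vacuous and all weight falls on ShortLagAutocorrDecay's existence clause).
sources: Bombieri2000Weil, arXiv:2511.22755, arXiv:2606.09096
[crux] if the set of off-line zeros of ζ in the critical strip is infinite, then there is A such
that for every window a ≥ A every real ground state u at a has autocorrelation NOT antitone on (0,1]
(the infinitely-many-walls case, named honestly as its own item). [difficulty: open-problem] -/
@[route_item "route-RiemannHypothesis-WeilAutocorrelation", crux]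
def OffLineAutocorrRiseInf : Prop :=
  let C : (ℝ → ℂ) → ℝ → ℂ := fun g => MeasureTheory.convolution g (fun t => (starRingEnd ℂ) (g (-t))) (ContinuousLinearMap.mul ℂ ℂ) MeasureTheory.MeasureSpace.volume; let M : (ℝ → ℂ) → ℂ → ℂ := fun F s => ∫ t : ℝ, F t * Complex.exp ((s - 1 / 2) * t); let Q : (ℝ → ℂ) → ℂ := fun g => M (C g) 0 + M (C g) 1 - (∑' n : ℕ, ((ArithmeticFunction.vonMangoldt n : ℝ) : ℂ) / (Real.sqrt n : ℂ) * (C g (Real.log n) + C g (-Real.log n))) + ((1 / (2 * Real.pi) : ℂ) * (∫ t : ℝ, M (C g) (1 / 2 + t * Complex.I) * ((Complex.digamma (1 / 4 + t / 2 * Complex.I)).re : ℂ)) - C g 0 * (Real.log Real.pi : ℂ)); {s : ℂ | riemannZeta s = 0 ∧ 0 < s.re ∧ s.re < 1 ∧ s.re ≠ 1 / 2}.Infinite → ∃ A : ℝ, ∀ a : ℝ, A ≤ a → ∀ u : ℝ → ℂ, (MeasureTheory.MemLp u 2 ∧ ∃ g : ℕ → ℝ → ℂ, (∀ n, (ContDiff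 ℝ ((⊤ : ℕ∞) : WithTop ℕ∞) (g n) ∧ HasCompactSupport (g n)) ∧ tsupport (g n) ⊆ Set.Icc (-a) a ∧ ∫ t, ‖g n t‖ ^ 2 = (1 : ℝ)) ∧ (∀ h : ℝ → ℂ, (ContDiff ℝ ((⊤ : ℕ∞) : WithTop ℕ∞) h ∧ HasCompactSupport h) → tsupport h ⊆ Set.Icc (-a) a → ∫ t, ‖h t‖ ^ 2 = (1 : ℝ) → ∀ δ : ℝ, 0 < δ → ∀ᶠ n in Filter.atTop, (Q (g n)).re ≤ (Q h).re + δ) ∧ Filter.Tendsto (fun n => ∫ t, ‖g n t - u t‖ ^ 2) Filter.atTop (nhds 0)) → (∀ᵐ t : ℝ, (u t).im = 0) → ¬ AntitoneOn (fun y : ℝ => ∫ t : ℝ, (u t).re * (u (t + y)).re) (Set.Ioc (0 : ℝ) 1)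

/-- item stmt-RiemannHypothesis-19994 · assembly · rank 1 · closed · proved by Summit.RiemannHypothesis.RiemannHypothesis.Theorems.WeilAutocorrelation.assembly_proof (prover) · by planner
sources: Bombieri2000Weil
[assembly] ShortLagAutocorrDecay → OffLineAutocorrRiseFin → OffLineAutocorrRiseInf → RH. -/
@[route_item "route-RiemannHypothesis-WeilAutocorrelation"]
def Assembly : Prop :=
  ShortLagAutocorrDecay → OffLineAutocorrRiseFin → OffLineAutocorrRiseInf → Summit.RiemannHypothesis

-- `Assembly` holds: proved by `Summit.RiemannHypothesis.RiemannHypothesis.Theorems.WeilAutocorrelation.assembly_proof` (its module imports this route file, so no `_holds` link can be stated here).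

/-! D-0027 §2.1 — DECIDING THEOREM (planner-authored via `route open/edit --closes-file`; by planner-type-d2b34ffd30-0 2026-08-17T19:06:09Z):
its hypotheses are this route's items and its conclusion the sub-problem Statement (glue_lint), and it elaborates with this file. -/

@[closes "route-RiemannHypothesis-WeilAutocorrelation"] theorem closes (h₁ : ShortLagAutocorrDecay) (h₂ : OffLineAutocorrRiseFin) (h₃ : OffLineAutocorrRiseInf) :
    _root_.Summit.RiemannHypothesis := by
  show _root_.RiemannHypothesis
  by_contra hRH
  rcases Set.finite_or_infinite {s : ℂ | riemannZeta s = 0 ∧ 0 < s.re ∧ s.re < 1 ∧ s.re ≠ 1 / 2} with hfin | hinf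
  · obtain ⟨A, hA⟩ := h₂ hRH hfin
    obtain ⟨a, ha, u, hu, hreal, hK⟩ := h₁ A
    exact hA a ha u hu hreal hK
  · obtain ⟨A, hA⟩ := h₃ hinf
    obtain ⟨a, ha, u, hu, hreal, hK⟩ := h₁ A
    exact hA a ha u hu hreal hK

end Summit.RiemannHypothesis.RiemannHypothesis.Theses.WeilAutocorrelation
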